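import Summits.QuantumAdvantage.AdviceFreeQNC0.ChargeRecursion
import HarnessLib

/-!
# Constant strategies of the u-walk game: the transfer-vector calculus and the pair contraction `5/8`

For a CONSTANT strategy (a fixed set `B` of fired cuts) the signed count `Σ_u (−1)^{N(u)}` of α's u-walk game
(`N(u) = #{g ∈ B : c + g + |u| + W_g(u) ≢ 0 (mod 3)}`) is a transfer-matrix quantity.  With the walk states
`s_g = g + W_g(u) (mod 3)` the steps are `+1`/`+2` (SYMMETRIC step matrix `P = S + S²`, `(P/2)^h = Π₀ + (−1/2)^h·Π₁`
exactly) and, for a fixed final state `s_n = τ`, every bell carries the SAME sign diagonal `s ↦ σ(κ₀ + s + τ)`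
(`κ₀ = c + 2n`), with exactly one `+1`.  This file is the linear-algebra layer, on vectors `ZMod 3 → ℝ`:

* `ConstBells.avg` (the step `P/2`), `sgnMul`, `nsq` (squared norm); `nsq_avg_le`, `nsq_sgnMul_le` (non-expansion);
* `avg_iterate` — the closed form `(P/2)^h v = m(v) + (−1/2)^h (v − m(v))`;
* **`pair_contract`** — two bells with gaps `h, h' ≥ 1` behind them contract the squared norm by `5/8`
  (planner qa-qnc0-p1 g16's certificate `‖M_g M_h‖_F² = (1 + 8α² + 8β² + 10α²β²)/9 ≤ 5/8`, ROUND-15 §9.7, re-derived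
  in u-coordinates; Cauchy–Schwarz row by row);
* `ConstBells.BV` — the backward transfer vector of a cut-indexed factor family `f`, and **`pathSum_eq`**: the path sum
  `Σ_{u ∈ {0,1}^k} Π_{j ≤ k} f_{g+j}(s + j + W_j(u))` equals `2^k · BV f g k s`; `nsq_BV_le` (non-expansion along the
  walk) and `BV_unroll` (a bell-free stretch is a power of `avg`).
WHAT THIS IS NOT: the counting theorem (≥ 21 bells ⇒ win ≤ 2/3) is in `ConstantBellsDense.lean`; separation NOT moved.
-/

noncomputable section

namespace Summit.QuantumAdvantage.AdviceFreeQNC0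

open Finset Literature.Computability.MetaComplexity

namespace ConstBells

/-! ### Vectors on `ZMod 3` -/

/-- The averaging step `(P/2) v (s) = (v(s+1) + v(s+2))/2`. -/
def avg (v : ZMod 3 → ℝ) : ZMod 3 → ℝ := fun s => (v (s + 1) + v (s + 2)) / 2

/-- Pointwise multiplication by a factor family `d`. -/
def sgnMul (d v : ZMod 3 → ℝ) : ZMod 3 → ℝ := fun s => d s * v s

/-- Squared Euclidean norm. -/
def nsq (v : ZMod 3 → ℝ) : ℝ := v 0 ^ 2 + v 1 ^ 2 + v 2 ^ 2

/-- The mean of a vector. -/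
def mean (v : ZMod 3 → ℝ) : ℝ := (v 0 + v 1 + v 2) / 3

/-- The sign diagonal with exactly one `+1`, at `r`. -/
def dOne (r : ZMod 3) : ZMod 3 → ℝ := fun s => if s = r then 1 else -1

/-- `nsq` is nonnegative. -/
theorem nsq_nonneg (v : ZMod 3 → ℝ) : 0 ≤ nsq v := by unfold nsq; positivity

/-- A coordinate is bounded by the norm: `v s ^ 2 ≤ nsq v`. -/
theorem sq_le_nsq (v : ZMod 3 → ℝ) (s : ZMod 3) : v s ^ 2 ≤ nsq v := by
  unfold nsq
  fin_cases s
  · show v 0 ^ 2 ≤ _; nlinarith [sq_nonneg (v 1), sq_nonneg (v 2)]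
  · show v 1 ^ 2 ≤ _; nlinarith [sq_nonneg (v 0), sq_nonneg (v 2)]
  · show v 2 ^ 2 ≤ _; nlinarith [sq_nonneg (v 0), sq_nonneg (v 1)]

/-- Addition table of `ZMod 3`, `+1`. -/
private theorem z3_add1 : ((0 : ZMod 3) + 1 = 1) ∧ ((1 : ZMod 3) + 1 = 2) ∧ ((2 : ZMod 3) + 1 = 0) := by decide
/-- Addition table of `ZMod 3`, `+2`. -/
private theorem z3_add2 : ((0 : ZMod 3) + 2 = 2) ∧ ((1 : ZMod 3) + 2 = 0) ∧ ((2 : ZMod 3) + 2 = 1) := by decide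

/-- `avg` at `0`. -/
theorem avg_apply_zero (v : ZMod 3 → ℝ) : avg v 0 = (v 1 + v 2) / 2 := by
  unfold avg; rw [z3_add1.1, z3_add2.1]
/-- `avg` at `1`. -/
theorem avg_apply_one (v : ZMod 3 → ℝ) : avg v 1 = (v 2 + v 0) / 2 := by
  unfold avg; rw [z3_add1.2.1, z3_add2.2.1]
/-- `avg` at `2`. -/
theorem avg_apply_two (v : ZMod 3 → ℝ) : avg v 2 = (v 0 + v 1) / 2 := by
  unfold avg; rw [z3_add1.2.2, z3_add2.2.2]

/-- The step `P/2` does not expand the norm. -/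
theorem nsq_avg_le (v : ZMod 3 → ℝ) : nsq (avg v) ≤ nsq v := by
  unfold nsq
  rw [avg_apply_zero, avg_apply_one, avg_apply_two]
  nlinarith [sq_nonneg (v 0 - v 1), sq_nonneg (v 1 - v 2), sq_nonneg (v 0 - v 2)]

/-- A factor family bounded by `1` does not expand the norm. -/
theorem nsq_sgnMul_le {d : ZMod 3 → ℝ} (hd : ∀ s, d s ^ 2 ≤ 1) (v : ZMod 3 → ℝ) :
    nsq (sgnMul d v) ≤ nsq v := by
  unfold nsq sgnMul
  have h0 := hd 0; have h1 := hd 1; have h2 := hd 2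
  nlinarith [sq_nonneg (v 0), sq_nonneg (v 1), sq_nonneg (v 2), mul_pow (d 0) (v 0) 2, mul_pow (d 1) (v 1) 2,
    mul_pow (d 2) (v 2) 2]

/-- `dOne r s = ±1`. -/
theorem dOne_sq (r s : ZMod 3) : dOne r s ^ 2 = 1 := by
  unfold dOne; split_ifs <;> norm_num

/-- `dOne r s ^ 2 ≤ 1`. -/
theorem dOne_sq_le (r s : ZMod 3) : dOne r s ^ 2 ≤ 1 := (dOne_sq r s).le

/-- The mean is invariant under the step. -/
theorem mean_avg (v : ZMod 3 → ℝ) : mean (avg v) = mean v := by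
  unfold mean; rw [avg_apply_zero, avg_apply_one, avg_apply_two]; ring

/-- The mean is invariant under the iterated step. -/
theorem mean_avg_iterate (h : ℕ) (v : ZMod 3 → ℝ) : mean (avg^[h] v) = mean v := by
  induction h with
  | zero => rfl
  | succ h ih => rw [Function.iterate_succ_apply', mean_avg, ih]

/-- **Closed form of the iterated step**: `(P/2)^h v = m(v)·𝟙 + (−1/2)^h (v − m(v)·𝟙)`. -/
theorem avg_iterate (h : ℕ) (v : ZMod 3 → ℝ) (s : ZMod 3) :
    (avg^[h] v) s = mean v + (-1 / 2 : ℝ) ^ h * (v s - mean v) := by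
  induction h generalizing s with
  | zero => simp
  | succ h ih =>
    rw [Function.iterate_succ_apply']
    fin_cases s
    · show avg (avg^[h] v) 0 = mean v + (-1 / 2 : ℝ) ^ (h + 1) * (v 0 - mean v)
      rw [avg_apply_zero, ih 1, ih 2]
      unfold mean; ring
    · show avg (avg^[h] v) 1 = mean v + (-1 / 2 : ℝ) ^ (h + 1) * (v 1 - mean v)
      rw [avg_apply_one, ih 2, ih 0]
      unfold mean; ring
    · show avg (avg^[h] v) 2 = mean v + (-1 / 2 : ℝ) ^ (h + 1) * (v 2 - mean v)
      rw [avg_apply_two, ih 0, ih 1]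
      unfold mean; ring

/-- Norm after the iterated step: `‖(P/2)^h v‖² = 3m² + 4^{-h}(‖v‖² − 3m²)`. -/
theorem nsq_avg_iterate (h : ℕ) (v : ZMod 3 → ℝ) :
    nsq (avg^[h] v) = 3 * mean v ^ 2 + ((-1 / 2 : ℝ) ^ h) ^ 2 * (nsq v - 3 * mean v ^ 2) := by
  unfold nsq
  rw [avg_iterate h v 0, avg_iterate h v 1, avg_iterate h v 2]
  unfold mean; ring

/-- A `±1` diagonal preserves the norm. -/
theorem nsq_sgnMul_dOne (r : ZMod 3) (v : ZMod 3 → ℝ) : nsq (sgnMul (dOne r) v) = nsq v := by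
  unfold nsq sgnMul
  rw [mul_pow, mul_pow, mul_pow, dOne_sq, dOne_sq, dOne_sq]; ring

/-- The off-diagonal `if`s on `ZMod 3` literals. -/
private theorem ite_z3 {x y : ℝ} :
    ((if (0 : ZMod 3) = 1 then x else y) = y) ∧ ((if (0 : ZMod 3) = 2 then x else y) = y) ∧
    ((if (1 : ZMod 3) = 0 then x else y) = y) ∧ ((if (1 : ZMod 3) = 2 then x else y) = y) ∧
    ((if (2 : ZMod 3) = 0 then x else y) = y) ∧ ((if (2 : ZMod 3) = 1 then x else y) = y) :=
  ⟨if_neg (by decide), if_neg (by decide), if_neg (by decide), if_neg (by decide), if_neg (by decide),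
    if_neg (by decide)⟩

/-- The mean after the one-plus sign diagonal: `m(D_r x) = (2 x_r − 3 m(x))/3`. -/
theorem mean_sgnMul_dOne (r : ZMod 3) (x : ZMod 3 → ℝ) :
    mean (sgnMul (dOne r) x) = (2 * x r - 3 * mean x) / 3 := by
  unfold mean sgnMul dOne
  fin_cases r
  · show ((if (0 : ZMod 3) = 0 then (1 : ℝ) else -1) * x 0 + (if (1 : ZMod 3) = 0 then (1 : ℝ) else -1) * x 1 +
        (if (2 : ZMod 3) = 0 then (1 : ℝ) else -1) * x 2) / 3 = (2 * x 0 - 3 * ((x 0 + x 1 + x 2) / 3)) / 3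
    rw [if_pos rfl, ite_z3.2.2.1, ite_z3.2.2.2.2.1]; ring
  · show ((if (0 : ZMod 3) = 1 then (1 : ℝ) else -1) * x 0 + (if (1 : ZMod 3) = 1 then (1 : ℝ) else -1) * x 1 +
        (if (2 : ZMod 3) = 1 then (1 : ℝ) else -1) * x 2) / 3 = (2 * x 1 - 3 * ((x 0 + x 1 + x 2) / 3)) / 3
    rw [if_pos rfl, ite_z3.1, ite_z3.2.2.2.2.2]; ring
  · show ((if (0 : ZMod 3) = 2 then (1 : ℝ) else -1) * x 0 + (if (1 : ZMod 3) = 2 then (1 : ℝ) else -1) * x 1 +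
        (if (2 : ZMod 3) = 2 then (1 : ℝ) else -1) * x 2) / 3 = (2 * x 2 - 3 * ((x 0 + x 1 + x 2) / 3)) / 3
    rw [if_pos rfl, ite_z3.2.1, ite_z3.2.2.2.1]; ring

/-- Bessel: the mean direction and the `(2,−1,−1)`-direction at `r` are orthogonal:
`3m² + (3/2)(v_r − m)² ≤ ‖v‖²`. -/
theorem bessel (r : ZMod 3) (v : ZMod 3 → ℝ) :
    3 * mean v ^ 2 + 3 / 2 * (v r - mean v) ^ 2 ≤ nsq v := by
  unfold mean nsq
  fin_cases r
  · show 3 * ((v 0 + v 1 + v 2) / 3) ^ 2 + 3 / 2 * (v 0 - (v 0 + v 1 + v 2) / 3) ^ 2 ≤ v 0 ^ 2 + v 1 ^ 2 + v 2 ^ 2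
    nlinarith [sq_nonneg (v 1 - v 2)]
  · show 3 * ((v 0 + v 1 + v 2) / 3) ^ 2 + 3 / 2 * (v 1 - (v 0 + v 1 + v 2) / 3) ^ 2 ≤ v 0 ^ 2 + v 1 ^ 2 + v 2 ^ 2
    nlinarith [sq_nonneg (v 0 - v 2)]
  · show 3 * ((v 0 + v 1 + v 2) / 3) ^ 2 + 3 / 2 * (v 2 - (v 0 + v 1 + v 2) / 3) ^ 2 ≤ v 0 ^ 2 + v 1 ^ 2 + v 2 ^ 2
    nlinarith [sq_nonneg (v 0 - v 1)]

/-- `((−1/2)^h)² ≤ 1/4` for `h ≥ 1`. -/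
theorem quarter_pow_sq_le {h : ℕ} (hh : 1 ≤ h) : ((-1 / 2 : ℝ) ^ h) ^ 2 ≤ 1 / 4 := by
  rw [← pow_mul, show (-1 / 2 : ℝ) = -(1 / 2) by ring, Even.neg_pow (by exact ⟨h, by ring⟩)]
  calc (1 / 2 : ℝ) ^ (h * 2) ≤ (1 / 2 : ℝ) ^ 2 := pow_le_pow_of_le_one (by norm_num) (by norm_num) (by omega)
    _ = 1 / 4 := by norm_num

/-! ### The pair contraction -/

/-- **Pair contraction** (planner qa-qnc0-p1 g16, ROUND-15 §9.7, in u-coordinates): two bells with the same one-plus sign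
pattern and gaps `h, h' ≥ 1` behind them contract the squared norm by `5/8`:
`‖D(P/2)^h D(P/2)^{h'} v‖² ≤ (5/8)‖v‖²`.  (The Frobenius norm² of the pair block is `(1 + 8α² + 8β² + 10α²β²)/9 ≤ 5/8`,
`α = (−1/2)^h`, `β = (−1/2)^{h'}`; here a direct estimate through the mean/Bessel decomposition.) -/
theorem pair_contract (r : ZMod 3) {h h' : ℕ} (hh : 1 ≤ h) (hh' : 1 ≤ h') (v : ZMod 3 → ℝ) :
    nsq (sgnMul (dOne r) (avg^[h] (sgnMul (dOne r) (avg^[h'] v)))) ≤ 5 / 8 * nsq v := by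
  set α : ℝ := (-1 / 2 : ℝ) ^ h with hα
  set β : ℝ := (-1 / 2 : ℝ) ^ h' with hβ
  have ha : α ^ 2 ≤ 1 / 4 := quarter_pow_sq_le hh
  have hb : β ^ 2 ≤ 1 / 4 := quarter_pow_sq_le hh'
  set w := sgnMul (dOne r) (avg^[h'] v) with hw
  set m := mean v with hm
  set y := v r - mean v with hy
  set N := nsq v with hN
  -- norms and means along the block
  have h1 : nsq (sgnMul (dOne r) (avg^[h] w)) = 3 * mean w ^ 2 + α ^ 2 * (nsq w - 3 * mean w ^ 2) := by
    rw [nsq_sgnMul_dOne, nsq_avg_iterate, hα]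
  have h2 : nsq w = 3 * m ^ 2 + β ^ 2 * (N - 3 * m ^ 2) := by
    rw [hw, nsq_sgnMul_dOne, nsq_avg_iterate, hm, hβ, hN]
  have h3 : mean w = (-m + 2 * β * y) / 3 := by
    rw [hw, mean_sgnMul_dOne, avg_iterate, mean_avg_iterate, hm, hy, hβ]; ring
  have hB : 3 * m ^ 2 + 3 / 2 * y ^ 2 ≤ N := bessel r v
  have hN0 : 0 ≤ N := nsq_nonneg v
  rw [h1, h2, h3]
  -- elementary estimate
  have hcross : (-m + 2 * β * y) ^ 2 ≤ 2 * m ^ 2 + 8 * β ^ 2 * y ^ 2 := by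
    nlinarith [sq_nonneg (m + 2 * β * y)]
  have hα0 : 0 ≤ α ^ 2 := sq_nonneg α
  have hβ0 : 0 ≤ β ^ 2 := sq_nonneg β
  have hmw0 : 0 ≤ ((-m + 2 * β * y) / 3) ^ 2 := sq_nonneg _
  have hm0 : 0 ≤ m ^ 2 := sq_nonneg m
  have hy0 : 0 ≤ y ^ 2 := sq_nonneg y
  nlinarith [mul_le_mul_of_nonneg_left ha hm0, mul_le_mul_of_nonneg_left hb hy0, mul_le_mul_of_nonneg_left hb hN0,
    mul_le_mul_of_nonneg_left ha hN0, mul_nonneg hα0 hβ0, mul_le_mul_of_nonneg_left hb hα0,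
    mul_nonneg hα0 hm0, mul_nonneg hβ0 hy0]

/-! ### The backward transfer vector of a factor family and the path sum -/

/-- The backward transfer vector at cut `g` with `k` steps to go: `BV f g 0 = f g`,
`BV f g (k+1) = f g · (P/2)(BV f (g+1) k)`. -/
def BV (f : ℕ → ZMod 3 → ℝ) : ℕ → ℕ → ZMod 3 → ℝ
  | g, 0 => f g
  | g, k + 1 => sgnMul (f g) (avg (BV f (g + 1) k))

/-- `BV` with no step left. -/
theorem BV_zero (f : ℕ → ZMod 3 → ℝ) (g : ℕ) : BV f g 0 = f g := rfl

/-- `W_0 = 0`. -/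
private theorem wtPrefix_zero₀ {m : ℕ} (u : Fin m → Bool) : wtPrefix u 0 = 0 := by
  unfold wtPrefix
  rw [Finset.card_eq_zero, Finset.filter_eq_empty_iff]
  intro i _ h
  exact absurd h.1 (Nat.not_lt_zero _)

/-- `BV` recursion. -/
theorem BV_succ (f : ℕ → ZMod 3 → ℝ) (g k : ℕ) : BV f g (k + 1) = sgnMul (f g) (avg (BV f (g + 1) k)) := rfl

/-- **Path sum = backward vector**: summing the product of the factors along the walk `s_j = s + j + W_j(u)` over all
`u ∈ {0,1}^k` gives `2^k · BV f g k s`. -/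
theorem pathSum_eq (f : ℕ → ZMod 3 → ℝ) (k : ℕ) : ∀ (g : ℕ) (s : ZMod 3),
    (∑ u : Fin k → Bool, ∏ j ∈ range (k + 1), f (g + j) (s + ((j + wtPrefix u j : ℕ) : ZMod 3))) =
      2 ^ k * BV f g k s := by
  induction k with
  | zero =>
    intro g s
    rw [BV_zero]
    simp [wtPrefix_zero₀]
  | succ k ih =>
    intro g s
    rw [BV_succ]
    -- split `u = Fin.cons b u'`
    rw [← Fintype.sum_equiv (Fin.consEquiv fun _ : Fin (k + 1) => Bool)
      (fun p : Bool × (Fin k → Bool) => ∏ j ∈ range (k + 1 + 1),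
        f (g + j) (s + ((j + wtPrefix (Fin.cons p.1 p.2 : Fin (k + 1) → Bool) j : ℕ) : ZMod 3)))
      _ (fun p => rfl), Fintype.sum_prod_type]
    have hinner : ∀ b : Bool, (∑ u' : Fin k → Bool, ∏ j ∈ range (k + 1 + 1),
        f (g + j) (s + ((j + wtPrefix (Fin.cons b u' : Fin (k + 1) → Bool) j : ℕ) : ZMod 3))) =
        f g s * (2 ^ k * BV f (g + 1) k (s + 1 + ((b.toNat : ℕ) : ZMod 3))) := by
      intro b
      rw [← ih (g + 1) (s + 1 + ((b.toNat : ℕ) : ZMod 3)), Finset.mul_sum]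
      refine Finset.sum_congr rfl fun u' _ => ?_
      rw [Finset.prod_range_succ' _ (k + 1)]
      rw [mul_comm]
      congr 1
      · simp [wtPrefix_zero₀]
      · refine Finset.prod_congr rfl fun j _ => ?_
        rw [wtPrefix_cons_succ]
        congr 1
        · ring
        · push_cast; ring
    rw [Fintype.sum_bool, hinner true, hinner false]
    simp only [Bool.toNat_true, Bool.toNat_false, Nat.cast_one, Nat.cast_zero, add_zero]
    unfold sgnMul avg
    rw [show s + 1 + (1 : ZMod 3) = s + 2 from by ring]
    ring

/-- Non-expansion along the walk when every factor is bounded by `1`. -/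
theorem nsq_BV_le (f : ℕ → ZMod 3 → ℝ) (hf : ∀ g s, f g s ^ 2 ≤ 1) (k : ℕ) :
    ∀ g j, j ≤ k → nsq (BV f g k) ≤ nsq (BV f (g + j) (k - j)) := by
  induction k with
  | zero => intro g j hj; have : j = 0 := by omega
            subst this; simp
  | succ k ih =>
    intro g j hj
    rcases Nat.eq_zero_or_pos j with rfl | hjpos
    · simp
    · obtain ⟨j', rfl⟩ : ∃ j', j = j' + 1 := ⟨j - 1, by omega⟩
      rw [BV_succ, show k + 1 - (j' + 1) = k - j' from by omega, show g + (j' + 1) = (g + 1) + j' from by ring]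
      calc nsq (sgnMul (f g) (avg (BV f (g + 1) k))) ≤ nsq (avg (BV f (g + 1) k)) := nsq_sgnMul_le (hf g) _
        _ ≤ nsq (BV f (g + 1) k) := nsq_avg_le _
        _ ≤ nsq (BV f (g + 1 + j') (k - j')) := ih (g + 1) j' (by omega)

/-- The final vector has norm `≤ 1` when it is an indicator times signs: `nsq (BV f g 0) = nsq (f g)`. -/
theorem nsq_BV_zero (f : ℕ → ZMod 3 → ℝ) (g : ℕ) : nsq (BV f g 0) = nsq (f g) := rfl

/-- Unrolling a factor-free stretch: if `f j = 1` for `g ≤ j < g + h` then `BV f g (h + k) = (P/2)^h (BV f (g+h) k)`. -/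
theorem BV_unroll_ones (f : ℕ → ZMod 3 → ℝ) (h : ℕ) : ∀ (g k : ℕ),
    (∀ j, g ≤ j → j < g + h → f j = fun _ => 1) → BV f g (h + k) = avg^[h] (BV f (g + h) k) := by
  induction h with
  | zero => intro g k _; simp
  | succ h ih =>
    intro g k hone
    rw [show h + 1 + k = (h + k) + 1 from by ring, BV_succ, hone g le_rfl (by omega),
      ih (g + 1) k (fun j h1 h2 => hone j (by omega) (by omega)), Function.iterate_succ_apply',
      show g + 1 + h = g + (h + 1) from by ring]
    funext s; unfold sgnMul; ring

/-- Unrolling a bell followed by a factor-free gap: `BV f g (h + k) = D_{f g} (P/2)^h (BV f (g+h) k)` when `f j = 1`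
for `g < j < g + h`, `h ≥ 1`. -/
theorem BV_unroll_bell (f : ℕ → ZMod 3 → ℝ) {h : ℕ} (hh : 1 ≤ h) (g k : ℕ)
    (hone : ∀ j, g < j → j < g + h → f j = fun _ => 1) :
    BV f g (h + k) = sgnMul (f g) (avg^[h] (BV f (g + h) k)) := by
  obtain ⟨h₀, rfl⟩ : ∃ h₀, h = h₀ + 1 := ⟨h - 1, by omega⟩
  rw [show h₀ + 1 + k = (h₀ + k) + 1 from by ring, BV_succ,
    BV_unroll_ones f h₀ (g + 1) k (fun j h1 h2 => hone j (by omega) (by omega)),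
    show g + 1 + h₀ = g + (h₀ + 1) from by ring, Function.iterate_succ_apply']

end ConstBells

end Summit.QuantumAdvantage.AdviceFreeQNC0

end
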